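import Literature.Probability.Process.StableLikeJumpChainLattice
import HarnessLib

/-!
# A parametrized Nash inequality for stable-like forms on `ℤ^d`

Support file for the proof of Bass–Levin 2002, Theorem 1.1
(`Literature.Probability.Process.bassLevin_thm_1_1`). For `g ∈ ℓ¹(ℤ^d)` and every integer
`r ≥ 1` we prove (`nash_parametrized`)

`∑_x g(x)² ≤ 2 r^α ∑_x ∑_{0<‖h‖≤r} ‖h‖^{-(d+α)} (g(x) - g(x+h))² + 2 (2r+1)^{-d} (∑_x |g(x)|)²`

by comparing `g` with its box averages `g_r(x) = (2r+1)^{-d} ∑_{‖h‖ ≤ r} g(x+h)`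
(`‖g_r‖₂² ≤ ‖g_r‖_∞ ‖g_r‖₁ ≤ (2r+1)^{-d} ‖g‖₁²` and, by Cauchy–Schwarz,
`‖g - g_r‖₂² ≤ (2r+1)^{-d} ∑_x ∑_{‖h‖≤r} (g(x)-g(x+h))²`). Optimising in `r` gives the
Nash inequality `‖g‖₂^{2+2α/d} ≤ C 𝓔(g) ‖g‖₁^{2α/d}` for any Dirichlet form whose jump kernel
dominates `‖h‖^{-(d+α)}`; we keep the parametrized form, which is what the discrete
Carlen–Kusuoka–Stroock iteration consumes. This replaces the Fourier-analytic comparison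
(Bass–Levin Props. 2.1–2.2, 4.1–4.2, via [BBG] Thm 1.2) in our route to the on-diagonal bound
(Bass–Levin Thm 4.3). [folklore]

## References
* R. F. Bass, D. A. Levin, *Transition probabilities for symmetric jump processes*,
  Trans. Amer. Math. Soc. 354 (2002) 2933–2953, Props. 2.1–2.2, 4.1–4.2, Thm 4.3.
* E. A. Carlen, S. Kusuoka, D. W. Stroock, *Upper bounds for symmetric Markov transition
  functions*, Ann. IHP 23 (1987) 245–287 (Nash inequalities).
-/

noncomputable section

namespace Literature.Probability.Process

open scoped BigOperators

variable {d : ℕ}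

/-- Translation invariance of sums over `ℤ^d`. [folklore] -/
theorem tsum_comp_add_right (g : (Fin d → ℤ) → ℝ) (h : Fin d → ℤ) :
    ∑' x, g (x + h) = ∑' x, g x :=
  (Equiv.addRight h).tsum_eq g

/-- Translation invariance of summability over `ℤ^d`. [folklore] -/
theorem summable_comp_add_right {g : (Fin d → ℤ) → ℝ} (hg : Summable g) (h : Fin d → ℤ) :
    Summable fun x => g (x + h) :=
  (Equiv.addRight h).summable_iff.mpr hg

/-- An `ℓ¹` function on `ℤ^d` is bounded by its `ℓ¹` norm. [folklore] -/
theorem abs_le_tsum_abs {g : (Fin d → ℤ) → ℝ} (hg : Summable fun x => |g x|) (x : Fin d → ℤ) :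
    |g x| ≤ ∑' y, |g y| :=
  hg.le_tsum x (fun _ _ => abs_nonneg _)

/-- An `ℓ¹` function on `ℤ^d` is square summable. [folklore] -/
theorem summable_sq_of_summable_abs {g : (Fin d → ℤ) → ℝ} (hg : Summable fun x => |g x|) :
    Summable fun x => g x ^ 2 := by
  refine (hg.mul_left (∑' y, |g y|)).of_nonneg_of_le (fun x => sq_nonneg _) (fun x => ?_)
  rw [← sq_abs, sq]
  exact mul_le_mul_of_nonneg_right (abs_le_tsum_abs hg x) (abs_nonneg _)

/-- A finite partial sum of translates is bounded by the full sum. [folklore] -/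
theorem sum_abs_comp_add_le_tsum {g : (Fin d → ℤ) → ℝ} (hg : Summable fun x => |g x|)
    (s : Finset (Fin d → ℤ)) (x : Fin d → ℤ) :
    ∑ h ∈ s, |g (x + h)| ≤ ∑' y, |g y| := by
  have : ∑ h ∈ s, |g (x + h)| = ∑ y ∈ s.map (Equiv.addLeft x).toEmbedding, |g y| := by
    rw [Finset.sum_map]
    rfl
  rw [this]
  exact hg.sum_le_tsum _ (fun y _ => abs_nonneg _)

/-- The energy density of a square-summable function against any finite family of jumps is
summable. [folklore] -/
theorem summable_energy_finset {g : (Fin d → ℤ) → ℝ} (hg2 : Summable fun x => g x ^ 2)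
    (F : Finset (Fin d → ℤ)) (w : (Fin d → ℤ) → ℝ) (hw : ∀ h, 0 ≤ w h) :
    Summable fun x => ∑ h ∈ F, w h * (g x - g (x + h)) ^ 2 := by
  refine summable_sum fun h _ => ?_
  refine ((hg2.add (summable_comp_add_right hg2 h)).mul_left (2 * w h)).of_nonneg_of_le
    (fun x => mul_nonneg (hw h) (sq_nonneg _)) (fun x => ?_)
  have : (g x - g (x + h)) ^ 2 ≤ 2 * (g x ^ 2 + g (x + h) ^ 2) := by
    nlinarith [sq_nonneg (g x + g (x + h))]
  calc w h * (g x - g (x + h)) ^ 2 ≤ w h * (2 * (g x ^ 2 + g (x + h) ^ 2)) :=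
        mul_le_mul_of_nonneg_left this (hw h)
    _ = 2 * w h * (g x ^ 2 + g (x + h) ^ 2) := by ring

/-- **Parametrized Nash inequality on `ℤ^d`.** For `g ∈ ℓ¹(ℤ^d)`, `α > 0` and an integer
`r ≥ 1`,
`∑_x g(x)² ≤ 2 r^α ∑_x ∑_{h ∈ box r, h ≠ 0} ‖h‖^{-(d+α)} (g x - g (x+h))² + 2 (2r+1)^{-d} (∑_x |g x|)²`.
[folklore] -/
theorem nash_parametrized {α : ℝ} (hα : 0 < α) {g : (Fin d → ℤ) → ℝ}
    (hg : Summable fun x => |g x|) {r : ℕ} (hr : 1 ≤ r) :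
    ∑' x, g x ^ 2 ≤
      2 * (r : ℝ) ^ α * ∑' x, ∑ h ∈ (Fintype.piFinset (fun _ : Fin d => Finset.Icc (-(r : ℤ)) r)).erase 0,
          ‖h‖ ^ (-((d : ℝ) + α)) * (g x - g (x + h)) ^ 2 +
      2 / ((2 * (r : ℝ) + 1) ^ d) * (∑' x, |g x|) ^ 2 := by
  set B : Finset (Fin d → ℤ) := Fintype.piFinset (fun _ : Fin d => Finset.Icc (-(r : ℤ)) r) with hB
  set N : ℝ := (2 * (r : ℝ) + 1) ^ d with hN
  set L : ℝ := ∑' y, |g y| with hL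
  set s : ℝ := (d : ℝ) + α with hs
  have hNpos : 0 < N := by rw [hN]; positivity
  have hcardB : (B.card : ℝ) = N := by
    rw [hB, card_box]; push_cast; rw [hN]
  have hLnn : 0 ≤ L := tsum_nonneg fun y => abs_nonneg _
  have hgabs : ∀ x, |g x| ≤ L := abs_le_tsum_abs hg
  have hg2 : Summable fun x => g x ^ 2 := summable_sq_of_summable_abs hg
  -- the box average
  set gr : (Fin d → ℤ) → ℝ := fun x => N⁻¹ * ∑ h ∈ B, g (x + h) with hgr
  have hgr_abs : ∀ x, |gr x| ≤ N⁻¹ * ∑ h ∈ B, |g (x + h)| := by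
    intro x
    rw [hgr]
    simp only
    rw [abs_mul, abs_of_pos (inv_pos.mpr hNpos)]
    exact mul_le_mul_of_nonneg_left (Finset.abs_sum_le_sum_abs _ _) (inv_nonneg.mpr hNpos.le)
  have hgr_bdd : ∀ x, |gr x| ≤ N⁻¹ * L := fun x =>
    (hgr_abs x).trans (mul_le_mul_of_nonneg_left (sum_abs_comp_add_le_tsum hg B x)
      (inv_nonneg.mpr hNpos.le))
  -- ℓ¹ bound for the averages
  have hmaj_s : Summable fun x => N⁻¹ * ∑ h ∈ B, |g (x + h)| :=
    (summable_sum fun h _ => summable_comp_add_right hg h).mul_left _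
  have hmaj_tsum : ∑' x, N⁻¹ * ∑ h ∈ B, |g (x + h)| = L := by
    rw [tsum_mul_left, Summable.tsum_finsetSum (fun h _ => summable_comp_add_right hg h)]
    have : ∀ h ∈ B, ∑' x, |g (x + h)| = L := fun h _ => tsum_comp_add_right (fun y => |g y|) h
    rw [Finset.sum_congr rfl this, Finset.sum_const, nsmul_eq_mul, hcardB,
      inv_mul_cancel_left₀ hNpos.ne']
  have hgr_l1s : Summable fun x => |gr x| :=
    hmaj_s.of_nonneg_of_le (fun x => abs_nonneg _) hgr_abs
  have hgr_l1 : ∑' x, |gr x| ≤ L := by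
    rw [← hmaj_tsum]; exact Summable.tsum_le_tsum hgr_abs hgr_l1s hmaj_s
  -- ℓ² bound for the averages
  have hgr2_pt : ∀ x, gr x ^ 2 ≤ N⁻¹ * L * |gr x| := by
    intro x
    rw [← sq_abs, sq]
    exact mul_le_mul_of_nonneg_right (hgr_bdd x) (abs_nonneg _)
  have hgr2_s : Summable fun x => gr x ^ 2 :=
    (hgr_l1s.mul_left (N⁻¹ * L)).of_nonneg_of_le (fun x => sq_nonneg _) hgr2_pt
  have hgr2 : ∑' x, gr x ^ 2 ≤ N⁻¹ * L ^ 2 := by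
    calc ∑' x, gr x ^ 2 ≤ ∑' x, N⁻¹ * L * |gr x| :=
          Summable.tsum_le_tsum hgr2_pt hgr2_s (hgr_l1s.mul_left _)
      _ = N⁻¹ * L * ∑' x, |gr x| := tsum_mul_left
      _ ≤ N⁻¹ * L * L := mul_le_mul_of_nonneg_left hgr_l1 (by positivity)
      _ = N⁻¹ * L ^ 2 := by ring
  -- the difference g - gr, by Cauchy–Schwarz over the box
  have hdiff_eq : ∀ x, g x - gr x = N⁻¹ * ∑ h ∈ B, (g x - g (x + h)) := by
    intro x
    rw [Finset.sum_sub_distrib, Finset.sum_const, nsmul_eq_mul, hcardB, mul_sub,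
      inv_mul_cancel_left₀ hNpos.ne']
  have hdiff : ∀ x, (g x - gr x) ^ 2 ≤ N⁻¹ * ∑ h ∈ B, (g x - g (x + h)) ^ 2 := by
    intro x
    rw [hdiff_eq x, mul_pow]
    have hcs := sq_sum_le_card_mul_sum_sq (s := B) (f := fun h => g x - g (x + h))
    rw [hcardB] at hcs
    calc N⁻¹ ^ 2 * (∑ h ∈ B, (g x - g (x + h))) ^ 2
        ≤ N⁻¹ ^ 2 * (N * ∑ h ∈ B, (g x - g (x + h)) ^ 2) :=
          mul_le_mul_of_nonneg_left hcs (by positivity)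
      _ = N⁻¹ * ∑ h ∈ B, (g x - g (x + h)) ^ 2 := by field_simp
  -- comparing with the stable kernel on the box
  have hker : ∀ h ∈ B.erase 0, (1 : ℝ) ≤ (r : ℝ) ^ s * ‖h‖ ^ (-s) := by
    intro h hh
    rw [Finset.mem_erase] at hh
    have hnorm : ‖h‖ ≤ r := (mem_box_iff h r).mp hh.2
    have h1 : 1 ≤ ‖h‖ := one_le_norm_of_ne_zero hh.1
    have hpos : 0 < ‖h‖ := by linarith
    have hr0 : (0 : ℝ) < r := by exact_mod_cast hr
    have hanti : (r : ℝ) ^ (-s) ≤ ‖h‖ ^ (-s) :=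
      Real.rpow_le_rpow_of_nonpos hpos hnorm (by rw [hs]; linarith [Nat.cast_nonneg (α := ℝ) d])
    calc (1 : ℝ) = (r : ℝ) ^ s * (r : ℝ) ^ (-s) := by
          rw [← Real.rpow_add hr0, add_neg_cancel, Real.rpow_zero]
      _ ≤ (r : ℝ) ^ s * ‖h‖ ^ (-s) := mul_le_mul_of_nonneg_left hanti (Real.rpow_nonneg hr0.le _)
  have hbox_le : ∀ x, ∑ h ∈ B, (g x - g (x + h)) ^ 2 ≤
      (r : ℝ) ^ s * ∑ h ∈ B.erase 0, ‖h‖ ^ (-s) * (g x - g (x + h)) ^ 2 := by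
    intro x
    have h0 : (0 : Fin d → ℤ) ∈ B := (mem_box_iff 0 r).mpr (by simp)
    rw [← Finset.add_sum_erase B _ h0, add_zero, sub_self, zero_pow two_ne_zero, zero_add,
      Finset.mul_sum]
    refine Finset.sum_le_sum fun h hh => ?_
    calc (g x - g (x + h)) ^ 2 = 1 * (g x - g (x + h)) ^ 2 := (one_mul _).symm
      _ ≤ ((r : ℝ) ^ s * ‖h‖ ^ (-s)) * (g x - g (x + h)) ^ 2 :=
          mul_le_mul_of_nonneg_right (hker h hh) (sq_nonneg _)
      _ = (r : ℝ) ^ s * (‖h‖ ^ (-s) * (g x - g (x + h)) ^ 2) := by ring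
  have hNr : N⁻¹ * (r : ℝ) ^ s ≤ (r : ℝ) ^ α := by
    have hr0 : (0 : ℝ) < r := by exact_mod_cast hr
    have hrd : (r : ℝ) ^ (d : ℝ) ≤ N := by
      rw [hN, Real.rpow_natCast]
      exact pow_le_pow_left₀ hr0.le (by linarith) d
    rw [hs, Real.rpow_add hr0, ← mul_assoc]
    calc N⁻¹ * (r : ℝ) ^ (d : ℝ) * (r : ℝ) ^ α ≤ 1 * (r : ℝ) ^ α := by
          refine mul_le_mul_of_nonneg_right ?_ (Real.rpow_nonneg hr0.le _)
          rw [inv_mul_le_iff₀ hNpos, mul_one]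
          exact hrd
      _ = (r : ℝ) ^ α := one_mul _
  -- pointwise inequality
  have hE_nn : ∀ x, 0 ≤ ∑ h ∈ B.erase 0, ‖h‖ ^ (-s) * (g x - g (x + h)) ^ 2 := fun x =>
    Finset.sum_nonneg fun h _ => mul_nonneg (Real.rpow_nonneg (norm_nonneg _) _) (sq_nonneg _)
  have hpt : ∀ x, g x ^ 2 ≤
      2 * (r : ℝ) ^ α * ∑ h ∈ B.erase 0, ‖h‖ ^ (-s) * (g x - g (x + h)) ^ 2 + 2 * gr x ^ 2 := by
    intro x
    have h1 : g x ^ 2 ≤ 2 * (g x - gr x) ^ 2 + 2 * gr x ^ 2 := by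
      nlinarith [sq_nonneg (g x - 2 * gr x)]
    have h2 : (g x - gr x) ^ 2 ≤ (r : ℝ) ^ α * ∑ h ∈ B.erase 0, ‖h‖ ^ (-s) * (g x - g (x + h)) ^ 2 :=
      calc (g x - gr x) ^ 2 ≤ N⁻¹ * ∑ h ∈ B, (g x - g (x + h)) ^ 2 := hdiff x
        _ ≤ N⁻¹ * ((r : ℝ) ^ s * ∑ h ∈ B.erase 0, ‖h‖ ^ (-s) * (g x - g (x + h)) ^ 2) :=
            mul_le_mul_of_nonneg_left (hbox_le x) (inv_nonneg.mpr hNpos.le)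
        _ = (N⁻¹ * (r : ℝ) ^ s) * ∑ h ∈ B.erase 0, ‖h‖ ^ (-s) * (g x - g (x + h)) ^ 2 := by ring
        _ ≤ (r : ℝ) ^ α * ∑ h ∈ B.erase 0, ‖h‖ ^ (-s) * (g x - g (x + h)) ^ 2 :=
            mul_le_mul_of_nonneg_right hNr (hE_nn x)
    linarith
  -- summability of the energy density
  have hE_s : Summable fun x => ∑ h ∈ B.erase 0, ‖h‖ ^ (-s) * (g x - g (x + h)) ^ 2 :=
    summable_energy_finset hg2 _ (fun h => ‖h‖ ^ (-s)) (fun h => Real.rpow_nonneg (norm_nonneg _) _)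
  -- sum the pointwise inequality
  calc ∑' x, g x ^ 2
      ≤ ∑' x, (2 * (r : ℝ) ^ α * ∑ h ∈ B.erase 0, ‖h‖ ^ (-s) * (g x - g (x + h)) ^ 2 +
          2 * gr x ^ 2) :=
        Summable.tsum_le_tsum hpt hg2 ((hE_s.mul_left _).add (hgr2_s.mul_left 2))
    _ = 2 * (r : ℝ) ^ α * ∑' x, ∑ h ∈ B.erase 0, ‖h‖ ^ (-s) * (g x - g (x + h)) ^ 2 +
          2 * ∑' x, gr x ^ 2 := by
        rw [Summable.tsum_add (hE_s.mul_left _) (hgr2_s.mul_left 2), tsum_mul_left, tsum_mul_left]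
    _ ≤ 2 * (r : ℝ) ^ α * ∑' x, ∑ h ∈ B.erase 0, ‖h‖ ^ (-s) * (g x - g (x + h)) ^ 2 +
          2 * (N⁻¹ * L ^ 2) := by linarith [hgr2]
    _ = _ := by rw [hs, hN, hL]; ring

end Literature.Probability.Process
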